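import Summits.KontsevichZagierPeriods.KontsevichZagierPeriods.Theses.AttractorUnfolding

/-!
# `FibrewiseCauchy` (stmt-KontsevichZagierPeriods-11362, route AttractorUnfolding, crux rank 4) — birth skeleton

Crux (E1, Cauchy's theorem with parameters, verbatim the route decl
`Summit.KontsevichZagierPeriods.KontsevichZagierPeriods.Theses.AttractorUnfolding.FibrewiseCauchy`): over a
`ℚ`-semialgebraic base `τ ⊆ ℝⁿ` with semialgebraic centre `c(x) ∈ ℂ` and radius `s(x) > 0`, and a family
`g(x, ·)` of rational functions of degree `≤ N`, pole-free on the CLOSED fibre disc `‖w − c x‖ ≤ s x`, with `Re g`,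
`Im g` semialgebraic on the disc bundle, the `(n+1)`-dimensional representation
`r = [τ × ℝ, Re (g(x, w(t)) · w′(t))]`, `w(t) = c + s(1+it)/(1−it)` (Cayley parametrisation of the fibre circle),
`w′ = 2is/(1−it)²`, lies in `KZ.relations`.

## Line "radial unfolding" (Cauchy–Goursat by Newton–Leibniz along the radius; NO partial fractions, NO root
branches, NO CAD)

Put `w_ρ(x,t) = c(x) + ρ·s(x)·(1+it)/(1−it)` (`0 ≤ ρ ≤ 1`), `F(x,t,ρ) = Re (g(x,w_ρ) · ∂ₜw_ρ)` (so `F(·,·,1)` is the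
integrand of `r` and `F(·,·,0) = 0` because `∂ₜw_ρ = ρ·2is/(1−it)²`), `H(x,t,ρ) = Re (g(x,w_ρ) · ∂_ρ w_ρ)`,
`∂_ρ w_ρ = s(1+it)/(1−it)`. Holomorphy of `g(x,·)` on the disc gives the exactness identity `∂_ρ F = ∂ₜ H`
(`d(g dw) = 0` pulled back to the `(t,ρ)`-half-strip). The chain:

* `stub_radialUnfoldingRep` (A, ANALYTIC / TAME — the hardest stub): the radially unfolded `(n+2)`-dimensional
  representation EXISTS: an `IntegralRep (n+2)` on the closed band `{(x,t,ρ) | x ∈ τ, 0 ≤ ρ ≤ 1}` whose integrand is,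
  on the open band, simultaneously `∂_ρ F` and `∂ₜ H`. Content: (i) exactness (holomorphy, chain rule); (ii) the
  integrand is `ℚ`-semialgebraic (derivative of a semialgebraic function: named facts
  `Literature.NumberTheory.Transcendental.IsSemialgebraicFunOn.hasDerivAt_isSemialgebraic` /
  `…hasDerivAt_last_isSemialgebraic`, composition `IsSemialgebraicFunOn.comp_isSemialgebraicMapOn`); (iii) ABSOLUTE
  INTEGRABILITY of `∂_ρ F` over `τ × ℝ × [0,1]` from that of `Re (g w′)` over `τ × ℝ` (the only integrability datum the
  crux carries, encoded as the hypothesis `∃ r, …`). Why it might fail: fibrewise the unfolded mass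
  `I₃(x) = ∫∫ |∂_ρ F| ≥ I₁(x) = ∫ |Re (g w′)| dt` with equality iff `ρ ↦ F` is monotone; for the family
  `g(x,w) = i/(w − p(x))` with the pole at distance `δ(x) → 0⁺` from the circle one has `I₁ = O(1)` but
  `I₃ ≍ log(1/δ(x))` (radial maximal function of a sign-changing harmonic function) — a LOGARITHMIC loss. The bet:
  tameness absorbs it — `ρ ↦ F(x,t,ρ)` is rational of degree `O(N)` so has `O(N)` monotonicity intervals, the radial
  maximal function of `Re Φ`, `Φ = iζ·g̃` holomorphic near the closed unit disc, is `≲ ‖Re Φ‖₁ + ‖Im Φ‖₁` on the circle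
  (Hardy–Littlewood / Burkholder–Gundy–Silverstein), `‖Im Φ‖₁ ≲ ‖Re Φ‖_{L log L}` (Zygmund), and for a non-negative
  SEMIALGEBRAIC (even constructible) `φ` with `∫ φ < ∞` one has `∫ φ log(2+φ) < ∞` (integrability of constructible
  functions is decided by strict exponent inequalities, Comte–Lion–Rolin 2000 / Cluckers–Miller 2011). Size L/XL.
* `stub_radialNewtonLeibniz` (B, ONE MOVE): for every such unfolded `r₃` (integrand = `∂_ρ F` on the open band),
  `[r] − [r₃] ∈ KZ.relations`: rule 3 along the last coordinate `ρ` on the band `0 ≤ ρ ≤ 1` over the base `r`, with the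
  semialgebraic primitive `F` (continuous on `[0,1]` since `g(x,·) = A/B` is continuous on the closed disc; `F(·,0) = 0`,
  `F(·,1) =` the integrand of `r`). Why it might fail: only the semialgebraicity of `F` on the band (composition of
  `Re g`, `Im g` on the disc bundle with the rational map `(x,t,ρ) ↦ (x, Re w_ρ, Im w_ρ)`; named fact
  `IsSemialgebraicFunOn.comp_isSemialgebraicMapOn`, Tarski–Seidenberg inside). Size M.
* `stub_exactnessRelation` (C, FOUR MOVES): for every unfolded `r₃` whose integrand is `∂ₜ H` on the open band,
  `[r₃] ∈ KZ.relations`: (1a) discard the null faces `ρ ∈ {0,1}`; (2) the change of variables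
  `(x,t,ρ) ↦ (x,ρ,φ(t))`, `φ : ℝ → (−1,1)` a semialgebraic diffeomorphism (swap + compactification, `|det| = φ′`);
  (1a) close the band at `u = ±1`; (3) Newton–Leibniz along `u` with the primitive `G(x,ρ,u) = H(x, φ⁻¹ u, ρ)`, which
  extends CONTINUOUSLY to `u = ±1` with the SAME value `Re (−s(x)·g(x, c(x) − ρ s(x)))` at both ends (the missing point
  `t = ±∞` of the Cayley parametrisation), so the base representation has integrand `G(·,1) − G(·,−1) = 0`; (1b) a
  zero-integrand representation is a relation. Why it might fail: bookkeeping only (semialgebraicity of `G` on the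
  closed band, continuity at `u = ±1`); the winding/log obstruction
  `Literature.Barriers.KontsevichZagierPeriods.noSemialgebraicPrimitive_inv_sub_two` does not bite because no
  primitive ALONG THE CIRCLE is ever taken — the primitives are `F` (radial) and `H` (angular, of the radial
  derivative), both algebraic in `g`. Size M/L.

Composition `fibrewiseCauchy_of_stubs : A → B → C → (crux unfolded verbatim)` is sorry-free algebra in the free
abelian group (`[r] = ([r] − [r₃]) + [r₃]`), and `FibrewiseCauchy_of : FibrewiseCauchy` feeds the three stubs in (the one
theorem of this file concluding the crux BY NAME).

Dead line avoided (recorded for the lead): the route docstring's suggested chain — fibrewise PARTIAL FRACTIONS over CAD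
cells of the pole branches `p_j(x)` — is defective as a chain of moves: where two outside poles merge the partial-fraction
coefficients blow up like `1/(p₁ − p₂)` and the individual pieces are NOT absolutely integrable over the cell (example:
`τ = (0,1)`, `c = 0`, `s = 1`, `g(x,w) = 1/((w−3)(w−3−x))`, pieces `∓x⁻¹/(w − …)`), so rule (1b) cannot be applied to
them; the radial unfolding never separates the poles and loses at most a logarithm.
Transfer noted (not used here): the parameter-free sibling `ComplexOrientations.CauchyMove` (stmt-11370) is PROVED in
tree by the Cartesian Green chain (`Theorems/ComplexOrientationsCauchyMove*.lean`: `green`, `boundaryP/Q`, `cov1`,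
`one_sub_mul_I_ne_zero`, `gamma_re/im`, `hasDerivAt_gamma`); with parameters that chain needs TWO unfolded
representations (`∂_v Re g`, `∂_u Im g` on the disc bundle) with the same tame-integrability issue as stub A, plus the
half-circle branch inversions — an alternative line, same hardest step.
Disproof used: none on file (no `Disproof.lean`, no dead lines, `ledger negatives` has one unrelated statement,
KinematicPlaneConvex stmt-5394). All statements are over existing declarations only (KZCalculus + Mathlib).
-/

set_option linter.dupNamespace false

namespace Summit.KontsevichZagierPeriods.KontsevichZagierPeriods.Cruxes.FibrewiseCauchy.Birth

open Literature.NumberTheory.Transcendental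
open Summit.KontsevichZagierPeriods.KontsevichZagierPeriods.Theses.AttractorUnfolding (FibrewiseCauchy)

/-- Stub A (`stub_radialUnfoldingRep`, the ANALYTIC / TAME stub — hardest): under the hypotheses of the crux on
`(τ, c, s, g, N)` and given that the circle-bundle integrand `Re (g(x,w(t)) w′(t))` is absolutely integrable over
`τ × ℝ` (encoded: some integral representation with that domain and integrand exists), the RADIALLY UNFOLDED
representation exists: an `IntegralRep (n+2)` on the closed band `{(x,t,ρ) | x ∈ τ, 0 ≤ ρ ≤ 1}` whose integrand is, at
every point of the open band, both `∂_ρ Re (g(x,w_ρ(t)) ∂ₜw_ρ(t))` and `∂ₜ Re (g(x,w_ρ(t)) ∂_ρ w_ρ(t))`,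
`w_ρ = c + ρ s (1+it)/(1−it)`. Exactness is holomorphy; semialgebraicity of the derivative is the named fact
`IsSemialgebraicFunOn.hasDerivAt_isSemialgebraic`; integrability is the tame `L log L` bet described in the module
docstring (why it might fail: a logarithmic loss `I₃(x) ≍ I₁(x)·log(1/δ(x))` when poles approach the circle; sources
KontsevichZagier2001 §1.2, BochnakCosteRoy1998 §2, Comte–Lion–Rolin 2000, Cluckers–Miller 2011, Zygmund `L log L`). -/
theorem stub_radialUnfoldingRep : ∀ (n N : ℕ) (τ : Set (Fin n → ℝ)) (c : (Fin n → ℝ) → ℂ) (s : (Fin n → ℝ) → ℝ) (g : (Fin n → ℝ) → ℂ → ℂ), Literature.ModelTheory.ExponentialFields.IsSemialgebraic ℚ τ → Literature.NumberTheory.Transcendental.IsSemialgebraicFunOn ℚ τ (fun x => (c x).re) → Literature.NumberTheory.Transcendental.IsSemialgebraicFunOn ℚ τ (fun x => (c x).im) → Literature.NumberTheory.Transcendental.IsSemialgebraicFunOn ℚ τ s → (∀ x ∈ τ, 0 < s x) → Literature.NumberTheory.Transcendental.IsSemialgebraicFunOn ℚ {p : Fin (n + 2) → ℝ | (Fin.init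 (Fin.init p) : Fin n → ℝ) ∈ τ ∧ ‖((Fin.init p (Fin.last n) : ℝ) : ℂ) + (p (Fin.last (n + 1)) : ℂ) * Complex.I - c (Fin.init (Fin.init p))‖ ≤ s (Fin.init (Fin.init p))} (fun p => (g (Fin.init (Fin.init p)) ((Fin.init p (Fin.last n) : ℂ) + (p (Fin.last (n + 1)) : ℂ) * Complex.I)).re) → Literature.NumberTheory.Transcendental.IsSemialgebraicFunOn ℚ {p : Fin (n + 2) → ℝ | (Fin.init (Fin.init p) : Fin n → ℝ) ∈ τ ∧ ‖((Fin.init p (Fin.last n) : ℝ) : ℂ) + (p (Fin.last (n + 1)) : ℂ) * Complex.I - c (Fin.init (Fin.init p))‖ ≤ s (Fin.init (Fin.init p))} (fun p => (g (Fin.init (Fin.init p)) ((Fin.init p (Fin.last n) : ℂ) + (p (Fin.last (n + 1)) : ℂ) * Complex.I)).im) → (∀ x ∈ τ, ∃ A B : Polynomial ℂ, A.natDegree ≤ N ∧ B.natDegree ≤ N ∧ ∀ w : ℂ, ‖w - c x‖ ≤ s x → B.eval w ≠ 0 ∧ g x w = A.eval w / B.eval w) → (∃ r : Literature.NumberTheory.Transcendental.KZ.IntegralRep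 (n + 1), r.domain = {z | (Fin.init z : Fin n → ℝ) ∈ τ} ∧ Set.EqOn r.integrand (fun z => (g (Fin.init z) (c (Fin.init z) + (s (Fin.init z) : ℂ) * (1 + (z (Fin.last n) : ℂ) * Complex.I) / (1 - (z (Fin.last n) : ℂ) * Complex.I)) * (2 * Complex.I * (s (Fin.init z) : ℂ) / (1 - (z (Fin.last n) : ℂ) * Complex.I) ^ 2)).re) r.domain) → ∃ r₃ : Literature.NumberTheory.Transcendental.KZ.IntegralRep (n + 2), r₃.domain = {p : Fin (n + 2) → ℝ | (Fin.init (Fin.init p) : Fin n → ℝ) ∈ τ ∧ 0 ≤ p (Fin.last (n + 1)) ∧ p (Fin.last (n + 1)) ≤ 1} ∧ ∀ p ∈ r₃.domain, 0 < p (Fin.last (n + 1)) → p (Fin.last (n + 1)) < 1 → HasDerivAt (fun ρ : ℝ => (g (Fin.init (Fin.init p)) (c (Fin.init (Fin.init p)) + (ρ : ℂ) * (s (Fin.init (Fin.init p)) : ℂ) * (1 + ((Fin.init p (Fin.last n) : ℝ) : ℂ) * Complex.I) / (1 - ((Fin.init p (Fin.last n) : ℝ) : ℂ) * Complex.I)) *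 ((ρ : ℂ) * (2 * Complex.I * (s (Fin.init (Fin.init p)) : ℂ) / (1 - ((Fin.init p (Fin.last n) : ℝ) : ℂ) * Complex.I) ^ 2))).re) (r₃.integrand p) (p (Fin.last (n + 1))) ∧ HasDerivAt (fun t : ℝ => (g (Fin.init (Fin.init p)) (c (Fin.init (Fin.init p)) + ((p (Fin.last (n + 1)) : ℝ) : ℂ) * (s (Fin.init (Fin.init p)) : ℂ) * (1 + (t : ℂ) * Complex.I) / (1 - (t : ℂ) * Complex.I)) * ((s (Fin.init (Fin.init p)) : ℂ) * (1 + (t : ℂ) * Complex.I) / (1 - (t : ℂ) * Complex.I))).re) (r₃.integrand p) (Fin.init p (Fin.last n)) := by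
  sorry

/-- Stub B (`stub_radialNewtonLeibniz`, ONE MOVE — rule 3 along the radius): if `r₃` is a representation on the closed
band `{(x,t,ρ) | x ∈ τ, 0 ≤ ρ ≤ 1}` whose integrand is `∂_ρ F`, `F(x,t,ρ) = Re (g(x,w_ρ(t)) ∂ₜw_ρ(t))`, on the open band,
then `[r] − [r₃] ∈ KZ.relations` for the circle-bundle representation `r` of the crux: one instance of
`KZ.newtonLeibnizRel` along the last coordinate with base `r`, endpoints `a = 0`, `b = 1` and primitive `F`
(`F(·,1) = r.integrand` on `r.domain`, `F(·,0) = 0`; `ρ ↦ F` is continuous on `[0,1]` because `g(x,·) = A/B` is continuous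
on the closed disc). Why it might fail: semialgebraicity of `F` on the band needs composition of `Re g`, `Im g` (given on
the disc bundle) with the rational map `(x,t,ρ) ↦ (x, Re w_ρ, Im w_ρ)` — named fact
`IsSemialgebraicFunOn.comp_isSemialgebraicMapOn` (Tarski–Seidenberg). Sources: KontsevichZagier2001 §1.2 rule 3,
BochnakCosteRoy1998 Prop. 2.2.6–2.2.7. -/
theorem stub_radialNewtonLeibniz : ∀ (n N : ℕ) (τ : Set (Fin n → ℝ)) (c : (Fin n → ℝ) → ℂ) (s : (Fin n → ℝ) → ℝ) (g : (Fin n → ℝ) → ℂ → ℂ) (r : Literature.NumberTheory.Transcendental.KZ.IntegralRep (n + 1)) (r₃ : Literature.NumberTheory.Transcendental.KZ.IntegralRep (n + 2)), Literature.ModelTheory.ExponentialFields.IsSemialgebraic ℚ τ → Literature.NumberTheory.Transcendental.IsSemialgebraicFunOn ℚ τ (fun x => (c x).re) → Literature.NumberTheory.Transcendental.IsSemialgebraicFunOn ℚ τ (fun x => (c x).im) → Literature.NumberTheory.Transcendental.IsSemialgebraicFunOn ℚ τ s → (∀ x ∈ τ, 0 < s x) → Literature.NumberTheory.Transcendental.IsSemialgebraicFunOn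 ℚ {p : Fin (n + 2) → ℝ | (Fin.init (Fin.init p) : Fin n → ℝ) ∈ τ ∧ ‖((Fin.init p (Fin.last n) : ℝ) : ℂ) + (p (Fin.last (n + 1)) : ℂ) * Complex.I - c (Fin.init (Fin.init p))‖ ≤ s (Fin.init (Fin.init p))} (fun p => (g (Fin.init (Fin.init p)) ((Fin.init p (Fin.last n) : ℂ) + (p (Fin.last (n + 1)) : ℂ) * Complex.I)).re) → Literature.NumberTheory.Transcendental.IsSemialgebraicFunOn ℚ {p : Fin (n + 2) → ℝ | (Fin.init (Fin.init p) : Fin n → ℝ) ∈ τ ∧ ‖((Fin.init p (Fin.last n) : ℝ) : ℂ) + (p (Fin.last (n + 1)) : ℂ) * Complex.I - c (Fin.init (Fin.init p))‖ ≤ s (Fin.init (Fin.init p))} (fun p => (g (Fin.init (Fin.init p)) ((Fin.init p (Fin.last n) : ℂ) + (p (Fin.last (n + 1)) : ℂ) * Complex.I)).im) → (∀ x ∈ τ, ∃ A B : Polynomial ℂ, A.natDegree ≤ N ∧ B.natDegree ≤ N ∧ ∀ w : ℂ, ‖w - c x‖ ≤ s x → B.eval w ≠ 0 ∧ g x w =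 A.eval w / B.eval w) → r.domain = {z | (Fin.init z : Fin n → ℝ) ∈ τ} → Set.EqOn r.integrand (fun z => (g (Fin.init z) (c (Fin.init z) + (s (Fin.init z) : ℂ) * (1 + (z (Fin.last n) : ℂ) * Complex.I) / (1 - (z (Fin.last n) : ℂ) * Complex.I)) * (2 * Complex.I * (s (Fin.init z) : ℂ) / (1 - (z (Fin.last n) : ℂ) * Complex.I) ^ 2)).re) r.domain → r₃.domain = {p : Fin (n + 2) → ℝ | (Fin.init (Fin.init p) : Fin n → ℝ) ∈ τ ∧ 0 ≤ p (Fin.last (n + 1)) ∧ p (Fin.last (n + 1)) ≤ 1} → (∀ p ∈ r₃.domain, 0 < p (Fin.last (n + 1)) → p (Fin.last (n + 1)) < 1 → HasDerivAt (fun ρ : ℝ => (g (Fin.init (Fin.init p)) (c (Fin.init (Fin.init p)) + (ρ : ℂ) * (s (Fin.init (Fin.init p)) : ℂ) * (1 + ((Fin.init p (Fin.last n) : ℝ) : ℂ) * Complex.I) / (1 - ((Fin.init p (Fin.last n) : ℝ) : ℂ) * Complex.I)) * ((ρ : ℂ) * (2 * Complex.I * (s (Fin.init (Fin.init p)) : ℂ)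 / (1 - ((Fin.init p (Fin.last n) : ℝ) : ℂ) * Complex.I) ^ 2))).re) (r₃.integrand p) (p (Fin.last (n + 1)))) → Literature.NumberTheory.Transcendental.KZ.of r - Literature.NumberTheory.Transcendental.KZ.of r₃ ∈ Literature.NumberTheory.Transcendental.KZ.relations := by
  sorry

/-- Stub C (`stub_exactnessRelation`, FOUR MOVES — the closed form `g dw` is exact on the unfolded band): if `r₃` is a
representation on the closed band whose integrand is `∂ₜ H`, `H(x,t,ρ) = Re (g(x,w_ρ(t)) ∂_ρ w_ρ(t))`,
`∂_ρ w_ρ = s(1+it)/(1−it)`, on the open band, then `[r₃] ∈ KZ.relations`: (1a) drop the null faces `ρ ∈ {0,1}`; (2) the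
change of variables `(x,t,ρ) ↦ (x,ρ,φ(t))` with `φ : ℝ → (−1,1)` a semialgebraic diffeomorphism (coordinate swap +
compactification, `|det| = φ′`); (1a) add the null faces `u = ±1`; (3) Newton–Leibniz along `u` on `[−1,1]` with the
semialgebraic primitive `G(x,ρ,u) = H(x,φ⁻¹ u,ρ)` extended continuously by the common limit
`Re (−s(x) g(x, c(x) − ρ s(x)))` at `u = ±1` (the missing point of the Cayley circle), so the base integrand is
`G(·,1) − G(·,−1) = 0`; (1b) zero-integrand representations are relations. Why it might fail: bookkeeping only
(semialgebraicity/continuity of `G` on the closed band; no primitive along the circle is taken, so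
`Literature.Barriers.KontsevichZagierPeriods.noSemialgebraicPrimitive_inv_sub_two` does not apply). Sources:
KontsevichZagier2001 §1.2 rules 1–3, BochnakCosteRoy1998 §2.2. -/
theorem stub_exactnessRelation : ∀ (n N : ℕ) (τ : Set (Fin n → ℝ)) (c : (Fin n → ℝ) → ℂ) (s : (Fin n → ℝ) → ℝ) (g : (Fin n → ℝ) → ℂ → ℂ) (r₃ : Literature.NumberTheory.Transcendental.KZ.IntegralRep (n + 2)), Literature.ModelTheory.ExponentialFields.IsSemialgebraic ℚ τ → Literature.NumberTheory.Transcendental.IsSemialgebraicFunOn ℚ τ (fun x => (c x).re) → Literature.NumberTheory.Transcendental.IsSemialgebraicFunOn ℚ τ (fun x => (c x).im) → Literature.NumberTheory.Transcendental.IsSemialgebraicFunOn ℚ τ s → (∀ x ∈ τ, 0 < s x) → Literature.NumberTheory.Transcendental.IsSemialgebraicFunOn ℚ {p : Fin (n + 2) → ℝ | (Fin.init (Fin.init p) : Fin n → ℝ) ∈ τ ∧ ‖((Fin.init p (Fin.last n) : ℝ) : ℂ) + (p (Fin.last (n + 1)) : ℂ) * Complex.I - c (Fin.init (Fin.init p))‖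 ≤ s (Fin.init (Fin.init p))} (fun p => (g (Fin.init (Fin.init p)) ((Fin.init p (Fin.last n) : ℂ) + (p (Fin.last (n + 1)) : ℂ) * Complex.I)).re) → Literature.NumberTheory.Transcendental.IsSemialgebraicFunOn ℚ {p : Fin (n + 2) → ℝ | (Fin.init (Fin.init p) : Fin n → ℝ) ∈ τ ∧ ‖((Fin.init p (Fin.last n) : ℝ) : ℂ) + (p (Fin.last (n + 1)) : ℂ) * Complex.I - c (Fin.init (Fin.init p))‖ ≤ s (Fin.init (Fin.init p))} (fun p => (g (Fin.init (Fin.init p)) ((Fin.init p (Fin.last n) : ℂ) + (p (Fin.last (n + 1)) : ℂ) * Complex.I)).im) → (∀ x ∈ τ, ∃ A B : Polynomial ℂ, A.natDegree ≤ N ∧ B.natDegree ≤ N ∧ ∀ w : ℂ, ‖w - c x‖ ≤ s x → B.eval w ≠ 0 ∧ g x w = A.eval w / B.eval w) → r₃.domain = {p : Fin (n + 2) → ℝ | (Fin.init (Fin.init p) : Fin n → ℝ) ∈ τ ∧ 0 ≤ p (Fin.last (n + 1)) ∧ p (Fin.last (n + 1)) ≤ 1} → (∀ p ∈ r₃.domain,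 0 < p (Fin.last (n + 1)) → p (Fin.last (n + 1)) < 1 → HasDerivAt (fun t : ℝ => (g (Fin.init (Fin.init p)) (c (Fin.init (Fin.init p)) + ((p (Fin.last (n + 1)) : ℝ) : ℂ) * (s (Fin.init (Fin.init p)) : ℂ) * (1 + (t : ℂ) * Complex.I) / (1 - (t : ℂ) * Complex.I)) * ((s (Fin.init (Fin.init p)) : ℂ) * (1 + (t : ℂ) * Complex.I) / (1 - (t : ℂ) * Complex.I))).re) (r₃.integrand p) (Fin.init p (Fin.last n))) → Literature.NumberTheory.Transcendental.KZ.of r₃ ∈ Literature.NumberTheory.Transcendental.KZ.relations := by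
  sorry

/-! ## The composition (sorry-free) -/

/-- The composition, arrow form: UNFOLDING EXISTS → RADIAL NEWTON–LEIBNIZ → EXACTNESS RELATION → the crux (conclusion =
`FibrewiseCauchy` UNFOLDED verbatim, so that exactly one theorem of this file, `FibrewiseCauchy_of`, concludes the crux by
its route name). Pure algebra in the free abelian group: `[r] = ([r] − [r₃]) + [r₃]`. [folklore] -/
theorem fibrewiseCauchy_of_stubs :
    (∀ (n N : ℕ) (τ : Set (Fin n → ℝ)) (c : (Fin n → ℝ) → ℂ) (s : (Fin n → ℝ) → ℝ) (g : (Fin n → ℝ) → ℂ → ℂ), Literature.ModelTheory.ExponentialFields.IsSemialgebraic ℚ τ → Literature.NumberTheory.Transcendental.IsSemialgebraicFunOn ℚ τ (fun x => (c x).re) → Literature.NumberTheory.Transcendental.IsSemialgebraicFunOn ℚ τ (fun x => (c x).im) → Literature.NumberTheory.Transcendental.IsSemialgebraicFunOn ℚ τ s → (∀ x ∈ τ, 0 < s x) → Literature.NumberTheory.Transcendental.IsSemialgebraicFunOn ℚ {p : Fin (n + 2) → ℝ | (Fin.init (Fin.init p) : Fin n → ℝ) ∈ τ ∧ ‖((Fin.init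 p (Fin.last n) : ℝ) : ℂ) + (p (Fin.last (n + 1)) : ℂ) * Complex.I - c (Fin.init (Fin.init p))‖ ≤ s (Fin.init (Fin.init p))} (fun p => (g (Fin.init (Fin.init p)) ((Fin.init p (Fin.last n) : ℂ) + (p (Fin.last (n + 1)) : ℂ) * Complex.I)).re) → Literature.NumberTheory.Transcendental.IsSemialgebraicFunOn ℚ {p : Fin (n + 2) → ℝ | (Fin.init (Fin.init p) : Fin n → ℝ) ∈ τ ∧ ‖((Fin.init p (Fin.last n) : ℝ) : ℂ) + (p (Fin.last (n + 1)) : ℂ) * Complex.I - c (Fin.init (Fin.init p))‖ ≤ s (Fin.init (Fin.init p))} (fun p => (g (Fin.init (Fin.init p)) ((Fin.init p (Fin.last n) : ℂ) + (p (Fin.last (n + 1)) : ℂ) * Complex.I)).im) → (∀ x ∈ τ, ∃ A B : Polynomial ℂ, A.natDegree ≤ N ∧ B.natDegree ≤ N ∧ ∀ w : ℂ, ‖w - c x‖ ≤ s x → B.eval w ≠ 0 ∧ g x w = A.eval w / B.eval w) → (∃ r : Literature.NumberTheory.Transcendental.KZ.IntegralRep (n + 1), r.domain = {z | (Fin.init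 z : Fin n → ℝ) ∈ τ} ∧ Set.EqOn r.integrand (fun z => (g (Fin.init z) (c (Fin.init z) + (s (Fin.init z) : ℂ) * (1 + (z (Fin.last n) : ℂ) * Complex.I) / (1 - (z (Fin.last n) : ℂ) * Complex.I)) * (2 * Complex.I * (s (Fin.init z) : ℂ) / (1 - (z (Fin.last n) : ℂ) * Complex.I) ^ 2)).re) r.domain) → ∃ r₃ : Literature.NumberTheory.Transcendental.KZ.IntegralRep (n + 2), r₃.domain = {p : Fin (n + 2) → ℝ | (Fin.init (Fin.init p) : Fin n → ℝ) ∈ τ ∧ 0 ≤ p (Fin.last (n + 1)) ∧ p (Fin.last (n + 1)) ≤ 1} ∧ ∀ p ∈ r₃.domain, 0 < p (Fin.last (n + 1)) → p (Fin.last (n + 1)) < 1 → HasDerivAt (fun ρ : ℝ => (g (Fin.init (Fin.init p)) (c (Fin.init (Fin.init p)) + (ρ : ℂ) * (s (Fin.init (Fin.init p)) : ℂ) * (1 + ((Fin.init p (Fin.last n) : ℝ) : ℂ) * Complex.I) / (1 - ((Fin.init p (Fin.last n) : ℝ) : ℂ) * Complex.I)) * ((ρ : ℂ) * (2 * Complex.I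 * (s (Fin.init (Fin.init p)) : ℂ) / (1 - ((Fin.init p (Fin.last n) : ℝ) : ℂ) * Complex.I) ^ 2))).re) (r₃.integrand p) (p (Fin.last (n + 1))) ∧ HasDerivAt (fun t : ℝ => (g (Fin.init (Fin.init p)) (c (Fin.init (Fin.init p)) + ((p (Fin.last (n + 1)) : ℝ) : ℂ) * (s (Fin.init (Fin.init p)) : ℂ) * (1 + (t : ℂ) * Complex.I) / (1 - (t : ℂ) * Complex.I)) * ((s (Fin.init (Fin.init p)) : ℂ) * (1 + (t : ℂ) * Complex.I) / (1 - (t : ℂ) * Complex.I))).re) (r₃.integrand p) (Fin.init p (Fin.last n))) →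
    (∀ (n N : ℕ) (τ : Set (Fin n → ℝ)) (c : (Fin n → ℝ) → ℂ) (s : (Fin n → ℝ) → ℝ) (g : (Fin n → ℝ) → ℂ → ℂ) (r : Literature.NumberTheory.Transcendental.KZ.IntegralRep (n + 1)) (r₃ : Literature.NumberTheory.Transcendental.KZ.IntegralRep (n + 2)), Literature.ModelTheory.ExponentialFields.IsSemialgebraic ℚ τ → Literature.NumberTheory.Transcendental.IsSemialgebraicFunOn ℚ τ (fun x => (c x).re) → Literature.NumberTheory.Transcendental.IsSemialgebraicFunOn ℚ τ (fun x => (c x).im) → Literature.NumberTheory.Transcendental.IsSemialgebraicFunOn ℚ τ s → (∀ x ∈ τ, 0 < s x) → Literature.NumberTheory.Transcendental.IsSemialgebraicFunOn ℚ {p : Fin (n + 2) → ℝ | (Fin.init (Fin.init p) : Fin n → ℝ) ∈ τ ∧ ‖((Fin.init p (Fin.last n) : ℝ) : ℂ) + (p (Fin.last (n + 1)) : ℂ) * Complex.I - c (Fin.init (Fin.init p))‖ ≤ s (Fin.init (Fin.init p))} (fun p => (g (Fin.init (Fin.init p)) ((Fin.init p (Fin.last n) : ℂ) + (p (Fin.last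 (n + 1)) : ℂ) * Complex.I)).re) → Literature.NumberTheory.Transcendental.IsSemialgebraicFunOn ℚ {p : Fin (n + 2) → ℝ | (Fin.init (Fin.init p) : Fin n → ℝ) ∈ τ ∧ ‖((Fin.init p (Fin.last n) : ℝ) : ℂ) + (p (Fin.last (n + 1)) : ℂ) * Complex.I - c (Fin.init (Fin.init p))‖ ≤ s (Fin.init (Fin.init p))} (fun p => (g (Fin.init (Fin.init p)) ((Fin.init p (Fin.last n) : ℂ) + (p (Fin.last (n + 1)) : ℂ) * Complex.I)).im) → (∀ x ∈ τ, ∃ A B : Polynomial ℂ, A.natDegree ≤ N ∧ B.natDegree ≤ N ∧ ∀ w : ℂ, ‖w - c x‖ ≤ s x → B.eval w ≠ 0 ∧ g x w = A.eval w / B.eval w) → r.domain = {z | (Fin.init z : Fin n → ℝ) ∈ τ} → Set.EqOn r.integrand (fun z => (g (Fin.init z) (c (Fin.init z) + (s (Fin.init z) : ℂ) * (1 + (z (Fin.last n) : ℂ) * Complex.I) / (1 - (z (Fin.last n) : ℂ) * Complex.I)) * (2 * Complex.I * (s (Fin.init z) : ℂ) / (1 - (z (Fin.last n) : ℂ) *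 Complex.I) ^ 2)).re) r.domain → r₃.domain = {p : Fin (n + 2) → ℝ | (Fin.init (Fin.init p) : Fin n → ℝ) ∈ τ ∧ 0 ≤ p (Fin.last (n + 1)) ∧ p (Fin.last (n + 1)) ≤ 1} → (∀ p ∈ r₃.domain, 0 < p (Fin.last (n + 1)) → p (Fin.last (n + 1)) < 1 → HasDerivAt (fun ρ : ℝ => (g (Fin.init (Fin.init p)) (c (Fin.init (Fin.init p)) + (ρ : ℂ) * (s (Fin.init (Fin.init p)) : ℂ) * (1 + ((Fin.init p (Fin.last n) : ℝ) : ℂ) * Complex.I) / (1 - ((Fin.init p (Fin.last n) : ℝ) : ℂ) * Complex.I)) * ((ρ : ℂ) * (2 * Complex.I * (s (Fin.init (Fin.init p)) : ℂ) / (1 - ((Fin.init p (Fin.last n) : ℝ) : ℂ) * Complex.I) ^ 2))).re) (r₃.integrand p) (p (Fin.last (n + 1)))) → Literature.NumberTheory.Transcendental.KZ.of r - Literature.NumberTheory.Transcendental.KZ.of r₃ ∈ Literature.NumberTheory.Transcendental.KZ.relations) →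
    (∀ (n N : ℕ) (τ : Set (Fin n → ℝ)) (c : (Fin n → ℝ) → ℂ) (s : (Fin n → ℝ) → ℝ) (g : (Fin n → ℝ) → ℂ → ℂ) (r₃ : Literature.NumberTheory.Transcendental.KZ.IntegralRep (n + 2)), Literature.ModelTheory.ExponentialFields.IsSemialgebraic ℚ τ → Literature.NumberTheory.Transcendental.IsSemialgebraicFunOn ℚ τ (fun x => (c x).re) → Literature.NumberTheory.Transcendental.IsSemialgebraicFunOn ℚ τ (fun x => (c x).im) → Literature.NumberTheory.Transcendental.IsSemialgebraicFunOn ℚ τ s → (∀ x ∈ τ, 0 < s x) → Literature.NumberTheory.Transcendental.IsSemialgebraicFunOn ℚ {p : Fin (n + 2) → ℝ | (Fin.init (Fin.init p) : Fin n → ℝ) ∈ τ ∧ ‖((Fin.init p (Fin.last n) : ℝ) : ℂ) + (p (Fin.last (n + 1)) : ℂ) * Complex.I - c (Fin.init (Fin.init p))‖ ≤ s (Fin.init (Fin.init p))} (fun p => (g (Fin.init (Fin.init p)) ((Fin.init p (Fin.last n) : ℂ) + (p (Fin.last (n + 1)) : ℂ) * Complex.I)).re) → Literature.NumberTheory.Transcendental.IsSemialgebraicFunOn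 ℚ {p : Fin (n + 2) → ℝ | (Fin.init (Fin.init p) : Fin n → ℝ) ∈ τ ∧ ‖((Fin.init p (Fin.last n) : ℝ) : ℂ) + (p (Fin.last (n + 1)) : ℂ) * Complex.I - c (Fin.init (Fin.init p))‖ ≤ s (Fin.init (Fin.init p))} (fun p => (g (Fin.init (Fin.init p)) ((Fin.init p (Fin.last n) : ℂ) + (p (Fin.last (n + 1)) : ℂ) * Complex.I)).im) → (∀ x ∈ τ, ∃ A B : Polynomial ℂ, A.natDegree ≤ N ∧ B.natDegree ≤ N ∧ ∀ w : ℂ, ‖w - c x‖ ≤ s x → B.eval w ≠ 0 ∧ g x w = A.eval w / B.eval w) → r₃.domain = {p : Fin (n + 2) → ℝ | (Fin.init (Fin.init p) : Fin n → ℝ) ∈ τ ∧ 0 ≤ p (Fin.last (n + 1)) ∧ p (Fin.last (n + 1)) ≤ 1} → (∀ p ∈ r₃.domain, 0 < p (Fin.last (n + 1)) → p (Fin.last (n + 1)) < 1 → HasDerivAt (fun t : ℝ => (g (Fin.init (Fin.init p)) (c (Fin.init (Fin.init p)) + ((p (Fin.last (n + 1)) : ℝ) : ℂ) * (s (Fin.init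 (Fin.init p)) : ℂ) * (1 + (t : ℂ) * Complex.I) / (1 - (t : ℂ) * Complex.I)) * ((s (Fin.init (Fin.init p)) : ℂ) * (1 + (t : ℂ) * Complex.I) / (1 - (t : ℂ) * Complex.I))).re) (r₃.integrand p) (Fin.init p (Fin.last n))) → Literature.NumberTheory.Transcendental.KZ.of r₃ ∈ Literature.NumberTheory.Transcendental.KZ.relations) →
    (∀ (n N : ℕ) (τ : Set (Fin n → ℝ)) (c : (Fin n → ℝ) → ℂ) (s : (Fin n → ℝ) → ℝ) (g : (Fin n → ℝ) → ℂ → ℂ) (r : Literature.NumberTheory.Transcendental.KZ.IntegralRep (n + 1)), Literature.ModelTheory.ExponentialFields.IsSemialgebraic ℚ τ → Literature.NumberTheory.Transcendental.IsSemialgebraicFunOn ℚ τ (fun x => (c x).re) → Literature.NumberTheory.Transcendental.IsSemialgebraicFunOn ℚ τ (fun x => (c x).im) → Literature.NumberTheory.Transcendental.IsSemialgebraicFunOn ℚ τ s → (∀ x ∈ τ, 0 < s x) → Literature.NumberTheory.Transcendental.IsSemialgebraicFunOn ℚ {p : Fin (n + 2) → ℝ | (Fin.init (Fin.init p) : Fin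 n → ℝ) ∈ τ ∧ ‖((Fin.init p (Fin.last n) : ℝ) : ℂ) + (p (Fin.last (n + 1)) : ℂ) * Complex.I - c (Fin.init (Fin.init p))‖ ≤ s (Fin.init (Fin.init p))} (fun p => (g (Fin.init (Fin.init p)) ((Fin.init p (Fin.last n) : ℂ) + (p (Fin.last (n + 1)) : ℂ) * Complex.I)).re) → Literature.NumberTheory.Transcendental.IsSemialgebraicFunOn ℚ {p : Fin (n + 2) → ℝ | (Fin.init (Fin.init p) : Fin n → ℝ) ∈ τ ∧ ‖((Fin.init p (Fin.last n) : ℝ) : ℂ) + (p (Fin.last (n + 1)) : ℂ) * Complex.I - c (Fin.init (Fin.init p))‖ ≤ s (Fin.init (Fin.init p))} (fun p => (g (Fin.init (Fin.init p)) ((Fin.init p (Fin.last n) : ℂ) + (p (Fin.last (n + 1)) : ℂ) * Complex.I)).im) → (∀ x ∈ τ, ∃ A B : Polynomial ℂ, A.natDegree ≤ N ∧ B.natDegree ≤ N ∧ ∀ w : ℂ, ‖w - c x‖ ≤ s x → B.eval w ≠ 0 ∧ g x w = A.eval w / B.eval w) → r.domain = {z | (Fin.init z : Fin n → ℝ) ∈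 τ} → Set.EqOn r.integrand (fun z => (g (Fin.init z) (c (Fin.init z) + (s (Fin.init z) : ℂ) * (1 + (z (Fin.last n) : ℂ) * Complex.I) / (1 - (z (Fin.last n) : ℂ) * Complex.I)) * (2 * Complex.I * (s (Fin.init z) : ℂ) / (1 - (z (Fin.last n) : ℂ) * Complex.I) ^ 2)).re) r.domain → Literature.NumberTheory.Transcendental.KZ.of r ∈ Literature.NumberTheory.Transcendental.KZ.relations) := by
  intro hA hB hC n N τ c s g r hτ hc1 hc2 hs hs0 hg1 hg2 hAB hdom hint
  obtain ⟨r₃, hdom₃, hder⟩ := hA n N τ c s g hτ hc1 hc2 hs hs0 hg1 hg2 hAB ⟨r, hdom, hint⟩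
  have h₁ : Literature.NumberTheory.Transcendental.KZ.of r - Literature.NumberTheory.Transcendental.KZ.of r₃ ∈
      Literature.NumberTheory.Transcendental.KZ.relations :=
    hB n N τ c s g r r₃ hτ hc1 hc2 hs hs0 hg1 hg2 hAB hdom hint hdom₃ (fun p hp h0 h1 => (hder p hp h0 h1).1)
  have h₂ : Literature.NumberTheory.Transcendental.KZ.of r₃ ∈ Literature.NumberTheory.Transcendental.KZ.relations :=
    hC n N τ c s g r₃ hτ hc1 hc2 hs hs0 hg1 hg2 hAB hdom₃ (fun p hp h0 h1 => (hder p hp h0 h1).2)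
  have h := add_mem h₁ h₂
  rwa [sub_add_cancel] at h

/-- **Skeleton theorem** (the one theorem of this file concluding the crux BY NAME): `FibrewiseCauchy` from the three
declared stubs via `fibrewiseCauchy_of_stubs`. -/
theorem FibrewiseCauchy_of : FibrewiseCauchy :=
  fibrewiseCauchy_of_stubs stub_radialUnfoldingRep stub_radialNewtonLeibniz stub_exactnessRelation

end Summit.KontsevichZagierPeriods.KontsevichZagierPeriods.Cruxes.FibrewiseCauchy.Birth
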